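/-
Copyright (c) 2026 the pub-hodgecm-mathlib formalisation cell (harness21).  Prover seat hodgecm-mathlib-K2E3-p23 (g5), HCML Track B «K2-LIT» ∕ h413
(`stmt-HodgeConjecture-24833`), line `K2_E3_EllipticInputs`, unit U12 «Characters», road «GL-[M6]-sc» (line lead K2E3-p23 (g5), dealer K2E3-plan (g3)),
MEMO «M6sc-BLUEPRINT v4» §1 (ASM): the `hball` majorant at an INTEGRAL REPRESENTATIVE, mixed case, and the two cases side by side.  2026-09-04.
-/
import Summits.HodgeConjecture.HodgeConjecture.Theorems.K2E3GL3ModUniformizerBallBoundMixed     -- ★ p858367 (this seat): the mixed mouth; brings VOL-transfer, VOL-mixed, T18-mixed (ED. 2), shift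
import Summits.HodgeConjecture.HodgeConjecture.Theorems.K2E3GL3ModUniformizerNonEllBallSplit   -- ★ p858391 (this seat): the split bound at an integral representative
import Summits.HodgeConjecture.HodgeConjecture.Theorems.K2E3GL3MixedCompanionNormalForm        -- ★ p858267 (K2E3-p17 g7): `exists_leviBlock_eq_conj_companion`, `charpoly_block_eq`
import Summits.HodgeConjecture.HodgeConjecture.Theorems.K2E3GL3ParabolicSliceRpowNegKit         -- ★ (K2E3-p17 g7): `discr_charpoly_parabolic`
import Summits.HodgeConjecture.HodgeConjecture.Theorems.K2E3SplitTorusDepthFromDiscriminant    -- ★ (K2E3-p14): `charpoly_discr_diagonal_fin_three`; brings `‖ϖ‖ = q⁻¹`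
import HarnessLib

/-!
# Road «GL-[M6]-sc», ASM brick: THE MIXED BALL BOUND AT AN INTEGRAL REPRESENTATIVE `g₁ = y · [[e₀,e₁,0],[e₂,e₃,0],[0,0,e₄]] · y⁻¹`, AND BOTH CASES
# IN ONE SHAPE `∫_{Ω R} ‖θ(x̄ · mk g₁ · x̄⁻¹)‖ dμ' ≤ M_θ · (c · C(m) · 3(2(R + 6h + L₀)+1)² · ‖2‖⁻¹ q^{m+1} · ‖disc χ_{g₁}‖^{-1∕2})` (Harish-Chandra 1970, VII §3)

Cell `pub/hodgecm-mathlib` (D-0151), Track B «K2-LIT», crux H413 = `stmt-HodgeConjecture-24833`, route of record `HCCMUnconditional`.  Lane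
`--supports stmt-HodgeConjecture-24833 --as helper`; THEOREMS ONLY (no `def`, no `instance`, no `notation`, no named-fact hypothesis, no `sorry`); count-neutral.

MIXED CASE.  The a.e. point `x̄ ∈ G'` is represented by an INTEGRAL `g₁` whose matrix is `y · [[e₀,e₁,0],[e₂,e₃,0],[0,0,e₄]] · y⁻¹` with `χ_{[[e₀,e₁],[e₂,e₃]]}`
irreducible (★ `ae_isCompact_centralizer_or_normalForm`).  The companion normal form (★ `exists_leviBlock_eq_conj_companion`) rewrites it as `y'·γ·y'⁻¹`,
`γ = [[0,−N₀,0],[1,T,0],[0,0,c₀]]`, `T = e₀+e₃`, `N₀ = e₀e₃−e₁e₂`, `c₀ = e₄`, `π = X² − TX + N₀` rootless (★ `forall_sq_sub_add_ne_zero_of_irreducible`);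
`disc χ_{g₁} = (T² − 4N₀)·π(c₀)²` (★ `discr_charpoly_parabolic`), `det g₁ = N₀ c₀` (★ `det_conj_companion_eq`), `|T|,|N₀|,|c₀| ≤ 1` (★ `v_T_le_one`,
`v_N_le_one`, `v_c_le_one`).  With `|disc χ_{g₁}| = q^{-L₀}` the depth hypothesis of ★ T18-mixed holds with `L = L₀`; the exponents `B`, `l` of the mixed
mouth ★ `exists_setIntegral_norm_conj_le_mixed` are read off `‖c₀ ϖ^{-m}‖ = q^{-B}`, `‖T² − 4N₀‖ = q^{-l}` (★ `exists_normAbs_eq_inv_zpow`, ★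
`normAbs_discr_le_normAbs_eval`), and its weight `‖c₀²∕π(c₀)‖ · ‖2‖⁻¹ q^{-(B − l + ⌊l∕2⌋)}` is at most `‖2‖⁻¹ · q^{m+1} · ‖disc χ_{g₁}‖^{-1∕2}` (§2, pure
`ℝ≥0` algebra: `q^{-⌊l∕2⌋} ≤ √q · √‖T²−4N₀‖`, `‖c₀‖³ ≤ 1`, `√q ≤ q`).
BOTH CASES.  `exists_setIntegral_norm_conj_le_of_integral_normalForm` puts the split bound (★ `exists_setIntegral_norm_conj_le_of_integral_split`, weight
`‖Δ(d)‖⁻¹ = ‖disc χ_{g₁}‖^{-1∕2} ≤ ‖2‖⁻¹ q^{m+1} ‖disc χ_{g₁}‖^{-1∕2}`) and the mixed bound under ONE conclusion, with the normal-form DISJUNCTION of ★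
`ae_isCompact_centralizer_or_normalForm` as hypothesis — the shape the a.e. packaging of `hball` consumes.
* §1 `exists_conj_eq_of_coe`, `discr_charpoly_leviBlock`; §2 `zpow_half_le_sqrt_mul_sqrt`, `mixedFactor_le`, `le_toReal_bound_mono`;
  §3 **`exists_setIntegral_norm_conj_le_of_integral_mixed`**; §4 **`exists_setIntegral_norm_conj_le_of_integral_normalForm`**.
HONEST LABEL: HC_CM is proved only modulo the 7 printed citations (2 remaining named inputs: hLiu418 = stmt-HodgeConjecture-24832, h413 = stmt-HodgeConjecture-24833) until
rung 0 closes; count-neutral helper, closes no socket.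

## References
* [HarishChandra1970] Harish-Chandra (notes by G. van Dijk), *Harmonic Analysis on Reductive p-adic Groups*, LNM 162 (1970), Part VII §2 Theorem 18 p. 69, §3 pp. 72–73.
-/

set_option autoImplicit false
-- the mandated namespace repeats the single-problem summit's segment (`HodgeConjecture.HodgeConjecture`)
set_option linter.dupNamespace false

noncomputable section

open MeasureTheory Measure Set
open scoped MatrixGroups NNReal ENNReal WithZero
open Literature.NumberTheory.Automorphic Literature.NumberTheory.GaloisRepresentations Literature.NumberTheory.GaloisRepresentations.IsNonarchimedeanLocalField
open Summit.HodgeConjecture.HodgeConjecture.Cruxes.H413.K2E3GL3ModUniformizerBallBoundMixed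
open Summit.HodgeConjecture.HodgeConjecture.Cruxes.H413.K2E3GL3ModUniformizerNonEllBallSplit
open Summit.HodgeConjecture.HodgeConjecture.Cruxes.H413.K2E3GL3MixedCompanionNormalForm
open Summit.HodgeConjecture.HodgeConjecture.Cruxes.H413.K2E3GL3MixedTorusNormForm
open Summit.HodgeConjecture.HodgeConjecture.Cruxes.H413.K2E3GL3TruncatedCharMixedTorusRadius
open Summit.HodgeConjecture.HodgeConjecture.Cruxes.H413.K2E3GL2EllipticConjugacyCount

namespace Summit.HodgeConjecture.HodgeConjecture.Cruxes.H413.K2E3GL3ModUniformizerNonEllBallMixed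

/-! ## §1 Algebra over a field -/
section Algebra

variable {F : Type*} [Field F]

/-- A matrix conjugate `↑g = ↑y · A · ↑y⁻¹` of an invertible `g` is realised by the group element `γ = y⁻¹ g y` with `↑γ = A`, `g = y γ y⁻¹`. [folklore] -/
theorem exists_conj_eq_of_coe {g y : GL (Fin 3) F} {A : Matrix (Fin 3) (Fin 3) F}
    (hg : (g : Matrix (Fin 3) (Fin 3) F) = (y : Matrix (Fin 3) (Fin 3) F) * A * ((y⁻¹ : GL (Fin 3) F) : Matrix (Fin 3) (Fin 3) F)) :
    ∃ γ : GL (Fin 3) F, (γ : Matrix (Fin 3) (Fin 3) F) = A ∧ g = y * γ * y⁻¹ := by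
  refine ⟨y⁻¹ * g * y, ?_, by group⟩
  rw [Units.val_mul, Units.val_mul, hg]
  simp only [Matrix.mul_assoc, Units.inv_mul, Matrix.mul_one, Units.inv_mul_cancel_left]

/-- **`disc χ` of the mixed normal form**: `disc χ_{[[e₀,e₁,0],[e₂,e₃,0],[0,0,e₄]]} = (T² − 4N₀) · (e₄² − T e₄ + N₀)²` with `T = e₀ + e₃`, `N₀ = e₀e₃ − e₁e₂`
(★ `discr_charpoly_parabolic`). [cite: HarishChandra1970, Part VII §3 p. 72] -/
theorem discr_charpoly_leviBlock (e : Fin 5 → F) :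
    ((!![e 0, e 1, 0; e 2, e 3, 0; 0, 0, e 4] : Matrix (Fin 3) (Fin 3) F)).charpoly.discr =
      ((e 0 + e 3) ^ 2 - 4 * (e 0 * e 3 - e 1 * e 2)) * (e 4 ^ 2 - (e 0 + e 3) * e 4 + (e 0 * e 3 - e 1 * e 2)) ^ 2 := by
  have h := K2E3GL3ParabolicSliceRpowNegKit.discr_charpoly_parabolic (R := F) ![e 0, e 1, 0, e 2, e 3, 0, e 4]
  simp only [Matrix.cons_val] at h
  rw [h]; ring

end Algebra

/-! ## §2 `ℝ≥0` bookkeeping: the mixed weight against `‖disc χ‖^{-1∕2}` -/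
section Weights

/-- `q^{-⌊l∕2⌋} ≤ √q · √(q^{-l})` for `q ≥ 1` (integer division loses at most `√q`). [folklore] -/
theorem zpow_half_le_sqrt_mul_sqrt {q : ℝ≥0} (hq : 1 ≤ q) (l : ℕ) :
    q⁻¹ ^ ((l : ℤ) / 2) ≤ NNReal.sqrt q * NNReal.sqrt (q⁻¹ ^ (l : ℤ)) := by
  have hq0 : q ≠ 0 := (zero_lt_one.trans_le hq).ne'
  have hr0 : q⁻¹ ≠ 0 := inv_ne_zero hq0
  rw [← NNReal.sqrt_mul, NNReal.le_sqrt_iff_sq_le, ← zpow_natCast, ← zpow_mul]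
  have h1 : q * q⁻¹ ^ (l : ℤ) = q⁻¹ ^ ((l : ℤ) - 1) := by
    rw [zpow_sub_one₀ hr0, inv_inv, mul_comm]
  rw [h1]
  exact zpow_le_zpow_right_of_le_one₀ (pos_iff_ne_zero.2 hr0) (inv_le_one_of_one_le₀ hq) (by push_cast; omega)

/-- **The mixed weight is at most `‖2‖⁻¹ q^{m+1} ‖disc χ‖^{-1∕2}`**: with `q^{-B} = a·q^m` (`a = ‖c₀‖ ≤ 1`), `q^{-l} = D` (`D = ‖T² − 4N₀‖`), `P = ‖π(c₀)‖`:
`a²∕P · t · q^{-(B − l + ⌊l∕2⌋)} ≤ t · q^{m+1} · (√(D·P²))⁻¹` (any `P`; both sides vanish at `P = 0` in `ℝ≥0`). [cite: HarishChandra1970, Part VII §3 p. 72] -/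
theorem mixedFactor_le {q a P D t : ℝ≥0} (hq : 1 ≤ q) (ha : a ≤ 1) (hD : D ≠ 0) {B : ℤ} {l m : ℕ}
    (hB : q⁻¹ ^ B = a * q ^ m) (hl : q⁻¹ ^ (l : ℤ) = D) :
    a ^ 2 / P * (t * q⁻¹ ^ (B - l + l / 2)) ≤ t * q ^ (m + 1) * (NNReal.sqrt (D * P ^ 2))⁻¹ := by
  have hq0 : q ≠ 0 := (zero_lt_one.trans_le hq).ne'
  have hr0 : q⁻¹ ≠ 0 := inv_ne_zero hq0
  have hsD : NNReal.sqrt D ≠ 0 := by simpa using hD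
  have hhalf : q⁻¹ ^ ((l : ℤ) / 2) ≤ NNReal.sqrt q * NNReal.sqrt D := by
    rw [← hl]; exact zpow_half_le_sqrt_mul_sqrt hq l
  have hdec : q⁻¹ ^ (B - l + l / 2) = a * q ^ m * D⁻¹ * q⁻¹ ^ ((l : ℤ) / 2) := by
    rw [zpow_add₀ hr0, zpow_sub₀ hr0, hB, hl, div_eq_mul_inv]
  have hsq : NNReal.sqrt (D * P ^ 2) = NNReal.sqrt D * P := by rw [NNReal.sqrt_mul, NNReal.sqrt_sq]
  have hDinv : D⁻¹ = (NNReal.sqrt D)⁻¹ * (NNReal.sqrt D)⁻¹ := by rw [← mul_inv, NNReal.mul_self_sqrt]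
  have hsqq : NNReal.sqrt q ≤ q := NNReal.sqrt_le_iff_le_sq.2 (le_self_pow₀ hq two_ne_zero)
  have ha3 : a ^ 3 ≤ 1 := pow_le_one₀ zero_le ha
  rw [hdec, hsq]
  calc a ^ 2 / P * (t * (a * q ^ m * D⁻¹ * q⁻¹ ^ ((l : ℤ) / 2)))
      ≤ a ^ 2 / P * (t * (a * q ^ m * D⁻¹ * (NNReal.sqrt q * NNReal.sqrt D))) := by gcongr
    _ = a ^ 3 * NNReal.sqrt q * (t * q ^ m * ((NNReal.sqrt D)⁻¹ * P⁻¹)) := by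
        rw [hDinv, div_eq_mul_inv]
        have : (NNReal.sqrt D)⁻¹ * (NNReal.sqrt D)⁻¹ * NNReal.sqrt D = (NNReal.sqrt D)⁻¹ := by
          rw [mul_assoc, inv_mul_cancel₀ hsD, mul_one]
        calc a ^ 2 * P⁻¹ * (t * (a * q ^ m * ((NNReal.sqrt D)⁻¹ * (NNReal.sqrt D)⁻¹) * (NNReal.sqrt q * NNReal.sqrt D)))
            = a ^ 3 * NNReal.sqrt q * (t * q ^ m * (((NNReal.sqrt D)⁻¹ * (NNReal.sqrt D)⁻¹ * NNReal.sqrt D) * P⁻¹)) := by ring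
          _ = _ := by rw [this]
    _ ≤ 1 * q * (t * q ^ m * ((NNReal.sqrt D)⁻¹ * P⁻¹)) := by gcongr
    _ = t * q ^ (m + 1) * (NNReal.sqrt D * P)⁻¹ := by rw [mul_inv, pow_succ]; ring

/-- Monotonicity of the road's bound shape `M_θ · (c · (C · n · X)).toReal` in `(c, C, n, X)` (`M_θ ≥ 0`, `C' < ∞`). [folklore] -/
theorem le_toReal_bound_mono {Mθ I : ℝ} (hM : 0 ≤ Mθ) {c c' : ℝ≥0} {C C' : ℝ≥0∞} {n n' : ℕ} {X X' : ℝ≥0}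
    (hc : c ≤ c') (hC : C ≤ C') (hC' : C' ≠ ⊤) (hn : n ≤ n') (hX : X ≤ X')
    (h : I ≤ Mθ * ((c : ℝ≥0∞) * (C * (n : ℝ≥0∞) * (X : ℝ≥0∞))).toReal) :
    I ≤ Mθ * ((c' : ℝ≥0∞) * (C' * (n' : ℝ≥0∞) * (X' : ℝ≥0∞))).toReal := by
  refine h.trans (mul_le_mul_of_nonneg_left (ENNReal.toReal_mono ?_ ?_) hM)
  · exact ENNReal.mul_ne_top ENNReal.coe_ne_top (ENNReal.mul_ne_top (ENNReal.mul_ne_top hC' (ENNReal.natCast_ne_top _)) ENNReal.coe_ne_top)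
  · exact mul_le_mul' (ENNReal.coe_le_coe.2 hc) (mul_le_mul' (mul_le_mul' hC (by exact_mod_cast hn)) (ENNReal.coe_le_coe.2 hX))

end Weights

/-! ## §2′ `‖ϖ‖ = q⁻¹` -/
section Uniformizer

variable {F : Type*} [Field F] [Valued F ℤᵐ⁰] [ValuativeRel F] [(Valued.v : Valuation F ℤᵐ⁰).Compatible] [IsNonarchimedeanLocalField F]

/-- `‖ϖ‖ = q⁻¹` for the road's uniformizer (`v ϖ = exp(−1)`; ★ `isUniformizingElement_of_v_eq`, ★ `normAbs_eq_inv_of_isUniformizingElement`). [folklore] -/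
theorem normAbs_uniformizer_eq_inv {ϖ : F} (hϖ : Valued.v ϖ = WithZero.exp (-1 : ℤ)) : normAbs F ϖ = (residueFieldCard F : ℝ≥0)⁻¹ :=
  normAbs_eq_inv_of_isUniformizingElement (isUniformizingElement_of_v_eq hϖ)

end Uniformizer

/-! ## §3 The mixed ball bound at an integral representative -/

variable {F : Type*} [Field F] [Valued F ℤᵐ⁰] [ValuativeRel F] [(Valued.v : Valuation F ℤᵐ⁰).Compatible] [IsNonarchimedeanLocalField F]
  [MeasurableSpace (GL (Fin 3) F)] [BorelSpace (GL (Fin 3) F)]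
  {ϖ : F} (hϖ : Valued.v ϖ = WithZero.exp (-1 : ℤ)) (hϖ0 : ϖ ≠ 0)
  [((Subgroup.zpowers (Units.mk0 ϖ hϖ0)).map (Matrix.GeneralLinearGroup.scalar (Fin 3))).Normal]
  [MeasurableSpace (GL (Fin 3) F ⧸ (Subgroup.zpowers (Units.mk0 ϖ hϖ0)).map (Matrix.GeneralLinearGroup.scalar (Fin 3)))]
  [BorelSpace (GL (Fin 3) F ⧸ (Subgroup.zpowers (Units.mk0 ϖ hϖ0)).map (Matrix.GeneralLinearGroup.scalar (Fin 3)))]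
  (μ' : Measure (GL (Fin 3) F ⧸ (Subgroup.zpowers (Units.mk0 ϖ hϖ0)).map (Matrix.GeneralLinearGroup.scalar (Fin 3)))) [μ'.IsHaarMeasure]

include hϖ in
/-- **THE MIXED BALL BOUND AT AN INTEGRAL REPRESENTATIVE.**  Constants `c`, `C` as in ★ `exists_setIntegral_norm_conj_le_mixed`; for `θ` bounded by `M_θ`, vanishing off `Ω m`;
`g₁` INTEGRAL with `(g₁ : Matrix) = y · [[e₀,e₁,0],[e₂,e₃,0],[0,0,e₄]] · y⁻¹`, `χ_{[[e₀,e₁],[e₂,e₃]]}` irreducible; `L₀` with `|disc χ_{g₁}| = q^{-L₀}`; any `R`: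
`∫_{Ω R} ‖θ(x̄ · mk g₁ · x̄⁻¹)‖ dμ' ≤ M_θ · (c · (C m · 3(2(R + L₀)+1)² · (‖2‖⁻¹ · q^{m+1} · ‖disc χ_{g₁}‖^{-1∕2}))).toReal`.
[cite: HarishChandra1970, Part VII §2 Theorem 18 p. 69; §3 pp. 72–73] -/
theorem exists_setIntegral_norm_conj_le_of_integral_mixed {E : Type*} [NormedAddCommGroup E] (h2 : (2 : F) ≠ 0)
    (Ω : ℕ → Set (GL (Fin 3) F ⧸ (Subgroup.zpowers (Units.mk0 ϖ hϖ0)).map (Matrix.GeneralLinearGroup.scalar (Fin 3))))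
    (hmem : ∀ (n : ℕ) (z : GL (Fin 3) F),
      (QuotientGroup.mk z : GL (Fin 3) F ⧸ (Subgroup.zpowers (Units.mk0 ϖ hϖ0)).map (Matrix.GeneralLinearGroup.scalar (Fin 3))) ∈ Ω n ↔
        ∀ i j k l, Valued.v (ϖ ^ n * ((z : Matrix (Fin 3) (Fin 3) F) i j * ((z⁻¹ : GL (Fin 3) F) : Matrix (Fin 3) (Fin 3) F) k l)) ≤ 1) :
    ∃ (c : ℝ≥0) (C : ℕ → ℝ≥0∞), (∀ m, C m ≠ ⊤) ∧
      ∀ (θ : GL (Fin 3) F ⧸ (Subgroup.zpowers (Units.mk0 ϖ hϖ0)).map (Matrix.GeneralLinearGroup.scalar (Fin 3)) → E) (Mθ : ℝ) (m : ℕ),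
        (∀ x, ‖θ x‖ ≤ Mθ) → (∀ x, x ∉ Ω m → θ x = 0) →
        ∀ (g₁ y : GL (Fin 3) F) (e : Fin 5 → F) (L₀ R : ℕ),
          Irreducible ((!![e 0, e 1; e 2, e 3] : Matrix (Fin 2) (Fin 2) F)).charpoly →
          (g₁ : Matrix (Fin 3) (Fin 3) F) =
            (y : Matrix (Fin 3) (Fin 3) F) * !![e 0, e 1, 0; e 2, e 3, 0; 0, 0, e 4] * ((y⁻¹ : GL (Fin 3) F) : Matrix (Fin 3) (Fin 3) F) →
          (∀ i j, Valued.v ((g₁ : Matrix (Fin 3) (Fin 3) F) i j) ≤ 1) →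
          Valued.v ((g₁ : Matrix (Fin 3) (Fin 3) F)).charpoly.discr = WithZero.exp (-(L₀ : ℤ)) →
          ∫ x in Ω R, ‖θ (x * QuotientGroup.mk g₁ * x⁻¹)‖ ∂μ' ≤
            Mθ * ((c : ℝ≥0∞) * (C m * ((3 * (2 * (R + L₀) + 1) ^ 2 : ℕ) : ℝ≥0∞) *
              ((normAbs F (2 : F))⁻¹ * (residueFieldCard F : ℝ≥0) ^ (m + 1) *
                (NNReal.sqrt (normAbs F ((g₁ : Matrix (Fin 3) (Fin 3) F)).charpoly.discr))⁻¹ : ℝ≥0))).toReal := by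
  obtain ⟨c, C, hC, hmouth⟩ := exists_setIntegral_norm_conj_le_mixed (E := E) hϖ hϖ0 μ' h2 Ω hmem
  refine ⟨c, C, hC, fun θ Mθ m hM hsupp g₁ y e L₀ R hirr hg hint hL₀ => ?_⟩
  have hMθ : 0 ≤ Mθ := (norm_nonneg _).trans (hM 1)
  -- companion normal form `g₁ = y' γ y'⁻¹`
  obtain ⟨y₂, hy₂⟩ := exists_leviBlock_eq_conj_companion e hirr
  set T : F := e 0 + e 3 with hTdef
  set N₀ : F := e 0 * e 3 - e 1 * e 2 with hN₀def
  set c₀ : F := e 4 with hc₀def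
  have hg' : (g₁ : Matrix (Fin 3) (Fin 3) F) = ((y * y₂ : GL (Fin 3) F) : Matrix (Fin 3) (Fin 3) F) * !![0, -N₀, 0; 1, T, 0; 0, 0, c₀] *
      (((y * y₂)⁻¹ : GL (Fin 3) F) : Matrix (Fin 3) (Fin 3) F) := by
    rw [hg, hy₂, mul_inv_rev, Units.val_mul, Units.val_mul]
    simp only [Matrix.mul_assoc]
  obtain ⟨γ, hγ, hg₁⟩ := exists_conj_eq_of_coe hg'
  set y' : GL (Fin 3) F := y * y₂ with hy'def
  -- `π = X² − TX + N₀` rootless; integrality; `c₀ ≠ 0`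
  have hπ : ∀ x : F, x ^ 2 - T * x + N₀ ≠ 0 := by
    refine forall_sq_sub_add_ne_zero_of_irreducible ?_
    rw [← charpoly_block_eq e]; exact hirr
  have hy : ∀ i j, Valued.v ((((y' * γ * y'⁻¹ : GL (Fin 3) F)) : Matrix (Fin 3) (Fin 3) F) i j) ≤ 1 := by rw [← hg₁]; exact hint
  have hdet : ((g₁ : Matrix (Fin 3) (Fin 3) F)).det = N₀ * c₀ := by rw [hg₁]; exact det_conj_companion_eq hγ
  have hdet0 : ((g₁ : Matrix (Fin 3) (Fin 3) F)).det ≠ 0 := ((Matrix.isUnit_iff_isUnit_det _).1 (Units.isUnit g₁)).ne_zero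
  have hc₀ : c₀ ≠ 0 := fun h => hdet0 (by rw [hdet, h, mul_zero])
  have hπc₀ : c₀ ^ 2 - T * c₀ + N₀ ≠ 0 := hπ c₀
  -- the discriminant
  have hdisc : ((g₁ : Matrix (Fin 3) (Fin 3) F)).charpoly.discr = (T ^ 2 - 4 * N₀) * (c₀ ^ 2 - T * c₀ + N₀) ^ 2 := by
    rw [hg, Matrix.coe_units_inv, Matrix.charpoly_units_conj, discr_charpoly_leviBlock]
  have hD0 : (T ^ 2 - 4 * N₀) * (c₀ ^ 2 - T * c₀ + N₀) ^ 2 ≠ 0 := by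
    rw [← hdisc]; intro h; rw [h, map_zero] at hL₀; exact WithZero.zero_ne_coe hL₀
  have hDπ0 : T ^ 2 - 4 * N₀ ≠ 0 := left_ne_zero_of_mul hD0
  -- depth `L = L₀`
  have hϖL : Valued.v (ϖ ^ L₀) = WithZero.exp (-(L₀ : ℤ)) := by
    rw [map_pow, hϖ, ← WithZero.exp_nsmul]; congr 1; simp
  have hL : Valued.v (ϖ ^ L₀) ≤ Valued.v ((T ^ 2 - 4 * N₀) * (c₀ ^ 2 - T * c₀ + N₀) ^ 2) := by rw [hϖL, ← hL₀, hdisc]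
  -- the exponents `B` and `l`
  obtain ⟨B, hB⟩ := exists_normAbs_eq_inv_zpow (F := F) (x := c₀ * (ϖ ^ m)⁻¹) (mul_ne_zero hc₀ (inv_ne_zero (pow_ne_zero _ hϖ0)))
  have hT1 : Valued.v T ≤ 1 := v_T_le_one hγ hy
  have hN1 : Valued.v N₀ ≤ 1 := v_N_le_one hγ hy
  have hc1 : Valued.v c₀ ≤ 1 := v_c_le_one hγ hy
  have hDπ1 : normAbs F (T ^ 2 - 4 * N₀) ≤ 1 := normAbs_le_one_iff.2 ((v_le_one_iff_mem_integer _).1 (v_discr_le_one hT1 hN1))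
  obtain ⟨k, hk⟩ := exists_normAbs_eq_inv_zpow hDπ0
  have hk0 : 0 ≤ k := by
    rw [hk] at hDπ1
    exact (zpow_le_one_iff_right_of_lt_one₀ inv_residueFieldCard_pos inv_residueFieldCard_lt_one).1 hDπ1
  obtain ⟨l, rfl⟩ := Int.eq_ofNat_of_zero_le hk0
  have hl : ∀ x : F, ((residueFieldCard F : ℝ≥0)⁻¹) ^ ((l : ℕ) : ℤ) ≤ normAbs F (x ^ 2 - T * x + N₀) := fun x => by
    rw [← hk]; exact normAbs_discr_le_normAbs_eval hπ x
  -- the mouth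
  have key := hmouth θ Mθ m hM hsupp T N₀ c₀ hπ hc₀ hπc₀ γ hγ y' L₀ R B l hy hL hB hl
  rw [← hg₁] at key
  refine le_toReal_bound_mono hMθ le_rfl le_rfl (hC m) le_rfl ?_ key
  -- compare the weights (§2)
  have hq1 : (1 : ℝ≥0) ≤ (residueFieldCard F : ℝ≥0) := one_lt_residueFieldCard_nnreal.le
  have ha1 : normAbs F c₀ ≤ 1 := normAbs_le_one_iff.2 ((v_le_one_iff_mem_integer _).1 hc1)
  have hD0' : normAbs F (T ^ 2 - 4 * N₀) ≠ 0 := (_root_.map_ne_zero _).2 hDπ0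
  have hB' : ((residueFieldCard F : ℝ≥0)⁻¹) ^ B = normAbs F c₀ * (residueFieldCard F : ℝ≥0) ^ m := by
    rw [← hB, map_mul, map_inv₀, map_pow, normAbs_uniformizer_eq_inv hϖ, inv_pow, inv_inv]
  rw [map_div₀, map_pow, hdisc, map_mul, map_pow]
  exact mixedFactor_le hq1 ha1 hD0' hB' hk.symm

/-! ## §4 Both cases in one shape (the normal-form disjunction of ★ `ae_isCompact_centralizer_or_normalForm`) -/

include hϖ in
/-- **THE BALL BOUND AT AN INTEGRAL REPRESENTATIVE, SPLIT OR MIXED.**  There are `c : ℝ≥0`, `C : ℕ → ℝ≥0∞` finite, such that for `θ` bounded by `M_θ` vanishing off `Ω m`,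
for every INTEGRAL `g₁` with `ϖ^h g₁⁻¹` integral, in split normal form (`y·diag d·y⁻¹`, `d` injective) OR mixed normal form (`y·[[e₀,e₁,0],[e₂,e₃,0],[0,0,e₄]]·y⁻¹`,
`χ_{[[e₀,e₁],[e₂,e₃]]}` irreducible), with `|disc χ_{g₁}| = q^{-L₀}`, and every `R`:
`∫_{Ω R} ‖θ(x̄ · mk g₁ · x̄⁻¹)‖ dμ' ≤ M_θ · (c · (C m · 3(2(R + (6h + L₀))+1)² · (‖2‖⁻¹ · q^{m+1} · ‖disc χ_{g₁}‖^{-1∕2}))).toReal`.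
[cite: HarishChandra1970, Part VII §2 Theorem 18 p. 69; §3 pp. 72–73] -/
theorem exists_setIntegral_norm_conj_le_of_integral_normalForm {E : Type*} [NormedAddCommGroup E] (h2 : (2 : F) ≠ 0)
    (Ω : ℕ → Set (GL (Fin 3) F ⧸ (Subgroup.zpowers (Units.mk0 ϖ hϖ0)).map (Matrix.GeneralLinearGroup.scalar (Fin 3))))
    (hmem : ∀ (n : ℕ) (z : GL (Fin 3) F),
      (QuotientGroup.mk z : GL (Fin 3) F ⧸ (Subgroup.zpowers (Units.mk0 ϖ hϖ0)).map (Matrix.GeneralLinearGroup.scalar (Fin 3))) ∈ Ω n ↔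
        ∀ i j k l, Valued.v (ϖ ^ n * ((z : Matrix (Fin 3) (Fin 3) F) i j * ((z⁻¹ : GL (Fin 3) F) : Matrix (Fin 3) (Fin 3) F) k l)) ≤ 1) :
    ∃ (c : ℝ≥0) (C : ℕ → ℝ≥0∞), (∀ m, C m ≠ ⊤) ∧
      ∀ (θ : GL (Fin 3) F ⧸ (Subgroup.zpowers (Units.mk0 ϖ hϖ0)).map (Matrix.GeneralLinearGroup.scalar (Fin 3)) → E) (Mθ : ℝ) (m : ℕ),
        (∀ x, ‖θ x‖ ≤ Mθ) → (∀ x, x ∉ Ω m → θ x = 0) →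
        ∀ (g₁ : GL (Fin 3) F) (h L₀ R : ℕ),
          ((∃ (y : GL (Fin 3) F) (d : Fin 3 → F), Function.Injective d ∧
              (g₁ : Matrix (Fin 3) (Fin 3) F) = (y : Matrix (Fin 3) (Fin 3) F) * Matrix.diagonal d * ((y⁻¹ : GL (Fin 3) F) : Matrix (Fin 3) (Fin 3) F)) ∨
            (∃ (y : GL (Fin 3) F) (e : Fin 5 → F), Irreducible ((!![e 0, e 1; e 2, e 3] : Matrix (Fin 2) (Fin 2) F)).charpoly ∧
              (g₁ : Matrix (Fin 3) (Fin 3) F) =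
                (y : Matrix (Fin 3) (Fin 3) F) * !![e 0, e 1, 0; e 2, e 3, 0; 0, 0, e 4] * ((y⁻¹ : GL (Fin 3) F) : Matrix (Fin 3) (Fin 3) F))) →
          (∀ i j, Valued.v ((g₁ : Matrix (Fin 3) (Fin 3) F) i j) ≤ 1) → (∀ i j, Valued.v (ϖ ^ h * ((g₁⁻¹ : GL (Fin 3) F) : Matrix (Fin 3) (Fin 3) F) i j) ≤ 1) →
          Valued.v ((g₁ : Matrix (Fin 3) (Fin 3) F)).charpoly.discr = WithZero.exp (-(L₀ : ℤ)) →
          ∫ x in Ω R, ‖θ (x * QuotientGroup.mk g₁ * x⁻¹)‖ ∂μ' ≤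
            Mθ * ((c : ℝ≥0∞) * (C m * ((3 * (2 * (R + (6 * h + L₀)) + 1) ^ 2 : ℕ) : ℝ≥0∞) *
              ((normAbs F (2 : F))⁻¹ * (residueFieldCard F : ℝ≥0) ^ (m + 1) *
                (NNReal.sqrt (normAbs F ((g₁ : Matrix (Fin 3) (Fin 3) F)).charpoly.discr))⁻¹ : ℝ≥0))).toReal := by
  obtain ⟨c₁, C₁, hC₁, hsplit⟩ := exists_setIntegral_norm_conj_le_of_integral_split (E := E) hϖ hϖ0 μ' Ω hmem
  obtain ⟨c₂, C₂, hC₂, hmixed⟩ := exists_setIntegral_norm_conj_le_of_integral_mixed (E := E) hϖ hϖ0 μ' h2 Ω hmem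
  refine ⟨c₁ + c₂, fun m => C₁ m + C₂ m, fun m => ENNReal.add_ne_top.2 ⟨hC₁ m, hC₂ m⟩, fun θ Mθ m hM hsupp g₁ h L₀ R hnf hint hinv hL₀ => ?_⟩
  have hMθ : 0 ≤ Mθ := (norm_nonneg _).trans (hM 1)
  have hq1 : (1 : ℝ≥0) ≤ (residueFieldCard F : ℝ≥0) := one_lt_residueFieldCard_nnreal.le
  -- `1 ≤ ‖2‖⁻¹ · q^{m+1}`
  have hw1 : (1 : ℝ≥0) ≤ (normAbs F (2 : F))⁻¹ * (residueFieldCard F : ℝ≥0) ^ (m + 1) := by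
    have h2' : normAbs F (2 : F) ≤ 1 := by exact_mod_cast normAbs_natCast_le_one (F := F) 2
    have h20 : normAbs F (2 : F) ≠ 0 := (_root_.map_ne_zero _).2 h2
    exact one_le_mul (one_le_inv_iff₀.2 ⟨pos_iff_ne_zero.2 h20, h2'⟩) (one_le_pow₀ hq1)
  rcases hnf with ⟨y, d, hd, hg⟩ | ⟨y, e, hirr, hg⟩
  · -- split: `Δ(d)² = disc χ_{g₁}`
    have hdisc : ((g₁ : Matrix (Fin 3) (Fin 3) F)).charpoly.discr = ((d 0 - d 1) * (d 0 - d 2) * (d 1 - d 2)) ^ 2 := by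
      rw [hg, Matrix.coe_units_inv, Matrix.charpoly_units_conj, K2E3SplitTorusDepthFromDiscriminant.charpoly_discr_diagonal_fin_three]; ring
    have key := hsplit θ Mθ m hM hsupp g₁ y d h L₀ R hd hg hint hinv (by rw [← hdisc]; exact hL₀)
    refine le_toReal_bound_mono hMθ le_self_add le_self_add (ENNReal.add_ne_top.2 ⟨hC₁ m, hC₂ m⟩) le_rfl ?_ key
    rw [hdisc, map_pow, NNReal.sqrt_sq]
    exact le_mul_of_one_le_left zero_le hw1
  · -- mixed
    have key := hmixed θ Mθ m hM hsupp g₁ y e L₀ R hirr hg hint hL₀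
    exact le_toReal_bound_mono hMθ le_add_self le_add_self (ENNReal.add_ne_top.2 ⟨hC₁ m, hC₂ m⟩)
      (Nat.mul_le_mul_left 3 (Nat.pow_le_pow_left (show 2 * (R + L₀) + 1 ≤ 2 * (R + (6 * h + L₀)) + 1 by omega) 2)) le_rfl key

end Summit.HodgeConjecture.HodgeConjecture.Cruxes.H413.K2E3GL3ModUniformizerNonEllBallMixed

end
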